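import Summits.QuantumFields.Balaban3D.Proofs.Run3Newborn
import Summits.QuantumFields.Balaban3D.Proofs.Run3RepresentationStd
import Literature.MathematicalPhysics.QuantumFieldTheory.Balaban1985CMP102.BindersNewborn

/-!
# Bałaban CMP 102 (1985) 255–275, d = 3 — prover seat p6 (lane `pub-balaban3d`): THE NEWBORN SLICE OF (46) IN
# PRINT'S CURRENCY — the contract `newborn46_series` / `newborn46_std` of lane rulings R-46N / R-46N′ (the `hnew` of
# seat p2's `Bound46Series.abs_pint_succ_le_gamma` / `Bound46Std.bound46_stdTowerInput`), from the C5/C7 inputs, the GAP binder G3D-07 `Binders.LogZLocalizedAsCited`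
# and the GAP binder G3D-08 `BindersNewborn.NewbornTerms45AsCited` BY NAME, with the constant `Cnew46`; plus the
# exact-currency theorems of `…Proofs.Run3Newborn` at the lane's STANDARD tower input

Source: T. Bałaban, Commun. Math. Phys. **102** (1985) 255–275 [Balaban1985UV3] (= [B10]), (46) p. 267 L10–12 «Summation
over y gives the factor (M₁L^jη)⁻³|Λ_k|, and finally summation over j = 1, …, k gives the following bound for the sum
of interaction terms in (41), Σ_{j=1}^{k} Σ_{Y_j} |𝒫_j(Y_j, U_k)| ≤ O(1)M₁³g²_{k−1}p²(g_{k−1})|Λ_k|»; loci of the inputs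
in the siblings `…Proofs.NewbornJet`, `…Proofs.Run3Newborn` and in `Balaban1985CMP102.BindersNewborn`.

HONEST FRAMING (lane PLAN.md §0).  [B10] proves UV stability of the d = 3 lattice gauge theory on a finite torus —
NOT a continuum limit, NOT infinite volume, NOT a mass gap, NOT d = 4, NOT Clay.  Nothing of the paper is asserted:
`newborn46_series` says «IF the expansion data `𝔖 k` of seat p1's `StepSeries` satisfy the (α) inputs of the
representation leaf C5 (G3D-01 `chart` at the (25)-rate, (28) `bound28`/`small28`, G3D-06 `far_le`, the identification
`hPY`), the GAP binder G3D-07 `Λc` with the identification `hPYZ` (leaf C7's inputs) and the GAP binder G3D-08 `N45`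
((44)–(45) AS CITED for the (61)-born pieces — the 7th GAP binder of the lane, booked 2026-08-22 on this seat's
FINDING that the chart data alone give those pieces only with an extra factor `r(g_k)²`, `…Proofs.NewbornJet`), THEN
`|PY_k h U + PYZ_k h U| ≤ Cnew46·(g_kp(g_k))²·|Λ_{k+1}(h)|`» — the terms of `Pint (k+1)` born at step k obey (46) with
`|Λ_{k+1}(h)| = #LamFin` (seat p1, R-LAMVOL) and the k-, ε-free constant `Cnew46` (seat p3's `Primitives`).
PLACEMENT: lane cell topic `Summits/QuantumFields/Balaban3D/Proofs/`.  Record: HOME `run/shared/lean/pub/pub-balaban3d/`.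
-/

noncomputable section

open scoped Topology
open Metric Set Finset MeasureTheory
open Literature.MathematicalPhysics.QuantumFieldTheory.Balaban1983to89
open Literature.MathematicalPhysics.QuantumFieldTheory.Balaban1983to89.B10
open Literature.MathematicalPhysics.QuantumFieldTheory.Balaban1983to89.B10SectAGathering
open Literature.MathematicalPhysics.QuantumFieldTheory.Balaban1983to89.B10Assembly
open Literature.MathematicalPhysics.QuantumFieldTheory.Balaban1983to89.B12TreeDecay (kappa₀ K₀ K₀_pos)
open Literature.MathematicalPhysics.QuantumFieldTheory.Balaban1983to89.TreeLengthTorus (tsys tcubeSys TPt)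
open Literature.MathematicalPhysics.QuantumFieldTheory.Balaban1985CMP102
open Literature.MathematicalPhysics.QuantumFieldTheory.Balaban1985CMP102.Setting
open Literature.MathematicalPhysics.QuantumFieldTheory.Balaban1985CMP102.Binders
  (ChartAnalyticityAsCited FarTermsDecayAsCited LogZLocalizedAsCited)
open Literature.MathematicalPhysics.QuantumFieldTheory.Balaban1985CMP102.BindersNewborn (NewbornTerms45AsCited)
open Summit.QuantumFields.Balaban3D.Proofs.Representation33
open Summit.QuantumFields.Balaban3D.Proofs.LogZLocalized
open Summit.QuantumFields.Balaban3D.Proofs.NewbornJet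
open Summit.QuantumFields.Balaban3D.Proofs.NewbornCount
open Summit.QuantumFields.Balaban3D.Proofs.Run3Representation
open Summit.QuantumFields.Balaban3D.Proofs.Run3RepresentationStd
open Summit.QuantumFields.Balaban3D.Proofs.Run3Newborn
open Summit.QuantumFields.Balaban3D.Carriers
open Summit.QuantumFields.Balaban3D.Proofs.ScalesArithmetic

namespace Summit.QuantumFields.Balaban3D.Proofs.Newborn46

/-! ## §1 The contract at the series' pieces (rulings R-46N / R-46N′): print's currency, G3D-07 + G3D-08 BY NAME -/

section Series

variable {L : ℕ} {S : Scales L} {G : Type} [GaugeGroup G] [MeasurableSpace G] [HaarData G]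
  {V : Type} [NormedAddCommGroup V] [NormedSpace ℂ V] [FiniteDimensional ℂ V] {Nc : ℕ → ℕ} [∀ k, NeZero (Nc k)]
  (B : TowerBase S G) (𝔖 : ∀ k, StepSeries S G V (Nc k) k) (C : ∀ k, PiecesParams S k) (k : ℕ)

/-- **THE CONSTANT `Cnew46` OF THE NEWBORN SLICE** (handed to seat p3's `Primitives`, ruling R-46N′): `K₀(32,6)·L³·
[C25·(20(cB/ρ)²·tl(2r₀,1) + Cfar·b₀⁵·tl(7r₀+5p₀,6)) + C63·C45]` — the perturbative part from the chart calculus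
(`NewbornJet`), the (61)-born part from the GAP binder G3D-08 (`C45`). [cite: Balaban1985UV3, (46) p.267] -/
def Cnew46 (L : ℕ) (κc : ChartConsts) (C25 C63 C45 b₀ p₀ : ℝ) : ℝ :=
  K₀ (4 * 2 ^ 3) (2 * 3) * (L : ℝ) ^ 3
    * (C25 * (20 * (κc.cB / κc.ρ) ^ 2 * tlConst (2 * κc.r₀) 1 + κc.Cfar * (b₀ ^ 5 * tlConst (7 * κc.r₀ + 5 * p₀) 6))
      + C63 * C45)

/-- `0 ≤ Cnew46` for nonnegative amplitudes and `r₀, p₀ > 0`, `b₀ ≥ 0`. [folklore] -/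
theorem Cnew46_nonneg (L : ℕ) (κc : ChartConsts) {C25 C63 C45 b₀ p₀ : ℝ} (hC25 : 0 ≤ C25) (hC63 : 0 ≤ C63)
    (hC45 : 0 ≤ C45) (hb₀ : 0 ≤ b₀) (hp₀ : 0 < p₀) (hr₀ : 0 < κc.r₀) : 0 ≤ Cnew46 L κc C25 C63 C45 b₀ p₀ := by
  have hK := K₀_pos (4 * 2 ^ 3) (2 * 3)
  have h1 := tlConst_nonneg (q := 2 * κc.r₀) (c := 1) (by linarith) one_pos
  have h2 := tlConst_nonneg (q := 7 * κc.r₀ + 5 * p₀) (c := 6) (by linarith) (by norm_num)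
  have := κc.Cfar_nonneg
  unfold Cnew46; positivity

/-- **R-46N — THE NEWBORN SLICE OF (46) IN PRINT'S CURRENCY, at `seriesPieces B 𝔖 C k`** (the contract text of lane
STATUS 2026-08-22T02:26:42Z, consumed as seat p2's `hnew` in `Bound46Series.abs_pint_succ_le` / `abs_pint_succ_le_gamma`): IF the expansion data
satisfy the C5 inputs (G3D-01 `chart` at the (25)-rate, (28) `bound28`/`small28` in the window, G3D-06 `far_le`, the
identification `hPY`), the GAP binder G3D-07 `Λc : Binders.LogZLocalizedAsCited` with the identification `hPYZ` (C7's
inputs), AND the GAP binder G3D-08 `N45 : BindersNewborn.NewbornTerms45AsCited … Λc C45` ((44)–(45) as cited for the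
(61)-born pieces), THEN for every history and field `|PY_k h U + PYZ_k h U| ≤ Cnew46·(g_kp(g_k))²·|Λ_{k+1}(h)|` with
`|Λ_{k+1}(h)| = #LamFin B.M₁ B.Rcol k h` — (46) p. 267 for the terms born at step k: the perturbative part by
`newbornY46_series` (no new input), the (61)-born part by G3D-08 summed with the tree-decay sum of (25)
(`NewbornJet.sum_le_of_inside`) and the count `card_ΩblkOf_le`.  No (32)/(26)/`hdet` needed. [cite: Balaban1985UV3, (46) p.267 + (33)–(34) p.264 + (61) p.271] -/
theorem newborn46_series (hk : k ≤ S.K) (hk1 : k + 1 ≤ S.P.m + S.P.K) (κc : ChartConsts) {κ C25 C63 C45 : ℝ}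
    (hκ : kappa₀ (4 * 2 ^ 3) (2 * 3) ≤ κ) (hC25 : 0 ≤ C25) (hC63 : 0 ≤ C63) (hb₀ : 0 ≤ B.b₀) (hp₀ : 0 < B.p₀)
    (hr₀ : 0 < κc.r₀) (hN : Nc k = max 1 (S.P.sitesPerDir k / B.M₁))
    (chart : ∀ X, ChartAnalyticityAsCited ((𝔖 k).Ψ X) κc.ρ
      (C25 * S.gk k * Real.exp (-(κ * (tsys 3 (Nc k)).dj X))))
    (bound28 : ∀ X h U, ‖(𝔖 k).Bcfg X h U‖ ≤ κc.cB * (rFun κc.r₀ (S.gk k) * S.gk k * pFun B.b₀ B.p₀ (S.gk k)))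
    (small28 : κc.cB * (rFun κc.r₀ (S.gk k) * S.gk k * pFun B.b₀ B.p₀ (S.gk k)) ≤ κc.ρ / 4)
    (far_le : FarTermsDecayAsCited (𝔖 k).far (fun X => C25 * S.gk k * Real.exp (-(κ * (tsys 3 (Nc k)).dj X)))
      κc.Cfar (S.gk k ^ 7 * (rFun κc.r₀ (S.gk k) * pFun B.b₀ B.p₀ (S.gk k)) ^ 7))
    (hPY : ∀ h U, (𝔖 k).PY h U
      = ∑ X ∈ (𝔖 k).loc (ΩblkOf B.M₁ B.Rcol (Nc k)) (B.Rret k) h,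
          ((jet26 ((𝔖 k).Ψ X) ((𝔖 k).Bcfg X h U)).re - (𝔖 k).far X h U))
    {Γ : Type} {π : Γ → (𝔖 k).E →L[ℂ] (𝔖 k).E}
    (Λc : LogZLocalizedAsCited (B.withSeries 𝔖 C).tower3.toTowerRun k (𝔖 k).E π κc.ρ κc.r₀ κc.Cfar C63 κ
      (seriesPieces B 𝔖 C k).logZU (seriesPieces B 𝔖 C k).logZ1 (𝔖 k).Bcfg
      (fun h => Finset.univ.filter fun X : (tsys 3 (Nc k)).Dom => X.1 ⊆ ΩblkOf B.M₁ B.Rcol (Nc k) h))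
    (N45 : NewbornTerms45AsCited (B.withSeries 𝔖 C).tower3.toTowerRun k (𝔖 k).E π κc.ρ κc.r₀ κc.Cfar C63 κ
      (seriesPieces B 𝔖 C k).logZU (seriesPieces B 𝔖 C k).logZ1 (𝔖 k).Bcfg
      (fun h => Finset.univ.filter fun X : (tsys 3 (Nc k)).Dom => X.1 ⊆ ΩblkOf B.M₁ B.Rcol (Nc k) h) Λc C45)
    (hPYZ : ∀ h U, (𝔖 k).PYZ h U
      = ∑ X ∈ (𝔖 k).loc (ΩblkOf B.M₁ B.Rcol (Nc k)) (B.Rret k) h,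
          ((jet26 (Λc.Ψ X) ((𝔖 k).Bcfg X h U)).re - Λc.far X h U)) :
    ∀ (h : Hist S.P (k + 1)) (U : GaugeField S.P (k + 1) G),
      |(𝔖 k).PY h U + (𝔖 k).PYZ h U|
        ≤ Cnew46 L κc C25 C63 C45 B.b₀ B.p₀ * (S.gk k * B10.pFun B.b₀ B.p₀ (S.gk k)) ^ 2
            * (LamFin B.M₁ B.Rcol k h).card := by
  intro h U
  have hK := K₀_pos (4 * 2 ^ 3) (2 * 3)
  have hY := newbornY46_series B 𝔖 k hk hk1 κc hκ hC25 hb₀ hp₀ hr₀ hN chart bound28 small28 far_le hPY h U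
  -- the (61)-born part: G3D-08 summed, then the tree-decay sum inside Ω_{k+1}(h), then the block count
  have hsumM : ∑ X ∈ (𝔖 k).loc (ΩblkOf B.M₁ B.Rcol (Nc k)) (B.Rret k) h,
        C63 * Real.exp (-(κ * (tsys 3 (Nc k)).dj X))
      ≤ C63 * K₀ (4 * 2 ^ 3) (2 * 3) * ((ΩblkOf B.M₁ B.Rcol (Nc k) h).card : ℝ) :=
    sum_le_of_inside (tcubeSys 3 (Nc k)) (TreeLengthTorus.tdegreeLE 3 _) (TreeLengthTorus.tvolumeLeaf 3 _) hκ
      hC63 (fun X => C63 * Real.exp (-(κ * (tsys 3 (Nc k)).dj X)))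
      (fun X => mul_nonneg hC63 (Real.exp_nonneg _)) (fun X => le_rfl) (ΩblkOf B.M₁ B.Rcol (Nc k) h)
      ((𝔖 k).loc (ΩblkOf B.M₁ B.Rcol (Nc k)) (B.Rret k) h) (cubes_subset_of_mem_loc B 𝔖 k h)
  have hcount := card_ΩblkOf_le_real B k hk1 hN h
  have hgp : 0 ≤ C45 * (S.gk k * pFun B.b₀ B.p₀ (S.gk k)) ^ 2 := mul_nonneg N45.C45_nonneg (sq_nonneg _)
  have hZ : |(𝔖 k).PYZ h U|
      ≤ C45 * (S.gk k * pFun B.b₀ B.p₀ (S.gk k)) ^ 2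
          * (C63 * K₀ (4 * 2 ^ 3) (2 * 3) * ((L : ℝ) ^ 3 * ((LamFin B.M₁ B.Rcol k h).card : ℝ))) := by
    rw [hPYZ h U]
    refine (N45.abs_sum_le _ h U).trans (mul_le_mul_of_nonneg_left (hsumM.trans ?_) hgp)
    exact mul_le_mul_of_nonneg_left hcount (mul_nonneg hC63 hK.le)
  calc |(𝔖 k).PY h U + (𝔖 k).PYZ h U| ≤ |(𝔖 k).PY h U| + |(𝔖 k).PYZ h U| := abs_add_le _ _
    _ ≤ _ := add_le_add hY hZ
    _ = _ := by unfold Cnew46; ring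

end Series

/-! ## §2 At the standard tower input (`nblkOf`, `rretOf`, `piecesParamsOf`: the count hypothesis by `rfl`) -/

section Std

variable {L : ℕ} {S : Scales L} {G : Type} [GaugeGroup G] [MeasurableSpace G] [HaarData G]
  {V : Type} [NormedAddCommGroup V] [NormedSpace ℂ V] [FiniteDimensional ℂ V]

/-- **R-46N, THE NEWBORN SLICE AT THE STANDARD TOWER, EXACT CURRENCY**: `newborn46Raw_series` at `seriesPieces
(X.toTowerBase K) 𝔖 (piecesParamsOf S K) k` — the label count `nblkOf S K k = max 1 ⌊spd_k/M₁⌋` by `rfl`; the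
hypotheses are LITERALLY those of `repr33_60_std` (minus `inv26`/`hdet`, not needed) and `decomp35_61_std` (with
`κc.r₀ = K.r₀` substituted by the consumer if desired). [cite: Balaban1985UV3, (46) p.267] -/
theorem newborn46Raw_std (X : ExternalInputs S G) (K : CarrierConsts)
    (𝔖 : ∀ k, StepSeries S G V (nblkOf S K k) k) (k : ℕ) (hk : k ≤ S.K) (hk1 : k + 1 ≤ S.P.m + S.P.K) (κc : ChartConsts) {κ C25 C63 : ℝ}
    (hκ : kappa₀ (4 * 2 ^ 3) (2 * 3) ≤ κ) (hC25 : 0 ≤ C25) (hC63 : 0 ≤ C63) (hb₀ : 0 ≤ K.b₀)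
    (chart : ∀ Y, ChartAnalyticityAsCited ((𝔖 k).Ψ Y) κc.ρ
      (C25 * S.gk k * Real.exp (-(κ * (tsys 3 (nblkOf S K k)).dj Y))))
    (bound28 : ∀ Y h U, ‖(𝔖 k).Bcfg Y h U‖ ≤ κc.cB * (rFun κc.r₀ (S.gk k) * S.gk k * pFun K.b₀ K.p₀ (S.gk k)))
    (small28 : κc.cB * (rFun κc.r₀ (S.gk k) * S.gk k * pFun K.b₀ K.p₀ (S.gk k)) ≤ κc.ρ / 4)
    (far_le : FarTermsDecayAsCited (𝔖 k).far
      (fun Y => C25 * S.gk k * Real.exp (-(κ * (tsys 3 (nblkOf S K k)).dj Y)))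
      κc.Cfar (S.gk k ^ 7 * (rFun κc.r₀ (S.gk k) * pFun K.b₀ K.p₀ (S.gk k)) ^ 7))
    (hPY : ∀ h U, (𝔖 k).PY h U
      = ∑ Y ∈ (𝔖 k).loc (ΩblkOf K.M₁ (rcolOf S K) (nblkOf S K k)) (rretOf S K k) h,
          ((jet26 ((𝔖 k).Ψ Y) ((𝔖 k).Bcfg Y h U)).re - (𝔖 k).far Y h U))
    (Λ : LogZLocalization (stdTowerInput X K 𝔖).tower3.toTowerRun k (𝔖 k).E κc κ C63
      (seriesPieces (X.toTowerBase K) 𝔖 (piecesParamsOf S K) k).logZU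
      (seriesPieces (X.toTowerBase K) 𝔖 (piecesParamsOf S K) k).logZ1 (𝔖 k).Bcfg
      (fun h => Finset.univ.filter fun Y : (tsys 3 (nblkOf S K k)).Dom =>
        Y.1 ⊆ ΩblkOf K.M₁ (rcolOf S K) (nblkOf S K k) h))
    (hPYZ : ∀ h U, (𝔖 k).PYZ h U
      = ∑ Y ∈ (𝔖 k).loc (ΩblkOf K.M₁ (rcolOf S K) (nblkOf S K k)) (rretOf S K k) h,
          ((jet26 (Λ.Ψ Y) ((𝔖 k).Bcfg Y h U)).re - Λ.far Y h U))
    (h : Hist S.P (k + 1)) (U : GaugeField S.P (k + 1) G) :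
    |(𝔖 k).PY h U + (𝔖 k).PYZ h U|
      ≤ K₀ (4 * 2 ^ 3) (2 * 3) * ((L : ℝ) ^ 3 * ((LamFin K.M₁ (rcolOf S K) k h).card : ℝ))
          * ((C25 * S.gk k + C63)
            * (20 * (κc.cB * (rFun κc.r₀ (S.gk k) * S.gk k * pFun K.b₀ K.p₀ (S.gk k)) / κc.ρ) ^ 2
                + κc.Cfar * (S.gk k ^ 7 * (rFun κc.r₀ (S.gk k) * pFun K.b₀ K.p₀ (S.gk k)) ^ 7))) :=
  newborn46Raw_series (X.toTowerBase K) 𝔖 (piecesParamsOf S K) k hk hk1 κc hκ hC25 hC63 hb₀ rfl chart bound28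
    small28 far_le hPY Λ hPYZ h U

/-- **The perturbative newborn terms at the standard tower in PRINT'S CURRENCY** (`newbornY46_series`):
`|PY_k h U| ≤ CnewY·(g_kp(g_k))²·L³·|Λ_{k+1}(h)|`, `CnewY := C25·K₀(32,6)·(20(cB/ρ)²·tl(2r₀,1) + Cfar·b₀⁵·tl(7r₀ +
5p₀, 6))`. [cite: Balaban1985UV3, (46) p.267] -/
theorem newbornY46_std (X : ExternalInputs S G) (K : CarrierConsts)
    (𝔖 : ∀ k, StepSeries S G V (nblkOf S K k) k) (k : ℕ) (hk : k ≤ S.K) (hk1 : k + 1 ≤ S.P.m + S.P.K) (κc : ChartConsts) {κ C25 : ℝ}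
    (hκ : kappa₀ (4 * 2 ^ 3) (2 * 3) ≤ κ) (hC25 : 0 ≤ C25) (hb₀ : 0 ≤ K.b₀) (hp₀ : 0 < K.p₀) (hr₀ : 0 < κc.r₀)
    (chart : ∀ Y, ChartAnalyticityAsCited ((𝔖 k).Ψ Y) κc.ρ
      (C25 * S.gk k * Real.exp (-(κ * (tsys 3 (nblkOf S K k)).dj Y))))
    (bound28 : ∀ Y h U, ‖(𝔖 k).Bcfg Y h U‖ ≤ κc.cB * (rFun κc.r₀ (S.gk k) * S.gk k * pFun K.b₀ K.p₀ (S.gk k)))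
    (small28 : κc.cB * (rFun κc.r₀ (S.gk k) * S.gk k * pFun K.b₀ K.p₀ (S.gk k)) ≤ κc.ρ / 4)
    (far_le : FarTermsDecayAsCited (𝔖 k).far
      (fun Y => C25 * S.gk k * Real.exp (-(κ * (tsys 3 (nblkOf S K k)).dj Y)))
      κc.Cfar (S.gk k ^ 7 * (rFun κc.r₀ (S.gk k) * pFun K.b₀ K.p₀ (S.gk k)) ^ 7))
    (hPY : ∀ h U, (𝔖 k).PY h U
      = ∑ Y ∈ (𝔖 k).loc (ΩblkOf K.M₁ (rcolOf S K) (nblkOf S K k)) (rretOf S K k) h,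
          ((jet26 ((𝔖 k).Ψ Y) ((𝔖 k).Bcfg Y h U)).re - (𝔖 k).far Y h U))
    (h : Hist S.P (k + 1)) (U : GaugeField S.P (k + 1) G) :
    |(𝔖 k).PY h U|
      ≤ C25 * K₀ (4 * 2 ^ 3) (2 * 3)
          * (20 * (κc.cB / κc.ρ) ^ 2 * tlConst (2 * κc.r₀) 1
              + κc.Cfar * (K.b₀ ^ 5 * tlConst (7 * κc.r₀ + 5 * K.p₀) 6))
          * ((S.gk k * pFun K.b₀ K.p₀ (S.gk k)) ^ 2
              * ((L : ℝ) ^ 3 * ((LamFin K.M₁ (rcolOf S K) k h).card : ℝ))) :=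
  newbornY46_series (X.toTowerBase K) 𝔖 k hk hk1 κc hκ hC25 hb₀ hp₀ hr₀ rfl chart bound28 small28 far_le hPY h U

/-- **The (61)-born newborn terms at the standard tower**, currency `(r(g_k)g_kp(g_k))²` (`newbornZ46r_series`):
`|PYZ_k h U| ≤ CnewZ·(r(g_k)g_kp(g_k))²·L³·|Λ_{k+1}(h)|`, `CnewZ := C63·K₀(32,6)·(20(cB/ρ)² + Cfar·b₀⁵·tl(5r₀+5p₀,5))`.
[cite: Balaban1985UV3, (46) p.267 + p.265 L14–16] -/
theorem newbornZ46r_std (X : ExternalInputs S G) (K : CarrierConsts)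
    (𝔖 : ∀ k, StepSeries S G V (nblkOf S K k) k) (k : ℕ) (hk : k ≤ S.K) (hk1 : k + 1 ≤ S.P.m + S.P.K) (κc : ChartConsts) {κ C63 : ℝ}
    (hκ : kappa₀ (4 * 2 ^ 3) (2 * 3) ≤ κ) (hC63 : 0 ≤ C63) (hb₀ : 0 ≤ K.b₀) (hp₀ : 0 < K.p₀) (hr₀ : 0 < κc.r₀)
    (bound28 : ∀ Y h U, ‖(𝔖 k).Bcfg Y h U‖ ≤ κc.cB * (rFun κc.r₀ (S.gk k) * S.gk k * pFun K.b₀ K.p₀ (S.gk k)))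
    (small28 : κc.cB * (rFun κc.r₀ (S.gk k) * S.gk k * pFun K.b₀ K.p₀ (S.gk k)) ≤ κc.ρ / 4)
    (Λ : LogZLocalization (stdTowerInput X K 𝔖).tower3.toTowerRun k (𝔖 k).E κc κ C63
      (seriesPieces (X.toTowerBase K) 𝔖 (piecesParamsOf S K) k).logZU
      (seriesPieces (X.toTowerBase K) 𝔖 (piecesParamsOf S K) k).logZ1 (𝔖 k).Bcfg
      (fun h => Finset.univ.filter fun Y : (tsys 3 (nblkOf S K k)).Dom =>
        Y.1 ⊆ ΩblkOf K.M₁ (rcolOf S K) (nblkOf S K k) h))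
    (hPYZ : ∀ h U, (𝔖 k).PYZ h U
      = ∑ Y ∈ (𝔖 k).loc (ΩblkOf K.M₁ (rcolOf S K) (nblkOf S K k)) (rretOf S K k) h,
          ((jet26 (Λ.Ψ Y) ((𝔖 k).Bcfg Y h U)).re - Λ.far Y h U))
    (h : Hist S.P (k + 1)) (U : GaugeField S.P (k + 1) G) :
    |(𝔖 k).PYZ h U|
      ≤ C63 * K₀ (4 * 2 ^ 3) (2 * 3)
          * (20 * (κc.cB / κc.ρ) ^ 2 + κc.Cfar * (K.b₀ ^ 5 * tlConst (5 * κc.r₀ + 5 * K.p₀) 5))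
          * ((rFun κc.r₀ (S.gk k) * S.gk k * pFun K.b₀ K.p₀ (S.gk k)) ^ 2
              * ((L : ℝ) ^ 3 * ((LamFin K.M₁ (rcolOf S K) k h).card : ℝ))) :=
  newbornZ46r_series (X.toTowerBase K) 𝔖 (piecesParamsOf S K) k hk hk1 κc hκ hC63 hb₀ hp₀ hr₀ rfl bound28
    small28 Λ hPYZ h U

/-- **R-46N AT THE STANDARD TOWER — the newborn slice in print's currency** (`newborn46_series` at `seriesPieces
(X.toTowerBase K) 𝔖 (piecesParamsOf S K) k`; the label count by `rfl`): the `hnew` of seat p2's `Bound46Series.abs_pint_succ_le_gamma` /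
`bound46_stdTowerInput`, modulo G3D-01/(28)/G3D-06/`hPY` (C5), G3D-07 + `hPYZ` (C7) and G3D-08 (`N45`), with
`Cnew := Cnew46 L κc C25 C63 C45 K.b₀ K.p₀`. [cite: Balaban1985UV3, (46) p.267] -/
theorem newborn46_std (X : ExternalInputs S G) (K : CarrierConsts)
    (𝔖 : ∀ k, StepSeries S G V (nblkOf S K k) k) (k : ℕ) (hk : k ≤ S.K) (hk1 : k + 1 ≤ S.P.m + S.P.K)
    (κc : ChartConsts) {κ C25 C63 C45 : ℝ} (hκ : kappa₀ (4 * 2 ^ 3) (2 * 3) ≤ κ) (hC25 : 0 ≤ C25)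
    (hC63 : 0 ≤ C63) (hb₀ : 0 ≤ K.b₀) (hp₀ : 0 < K.p₀) (hr₀ : 0 < κc.r₀)
    (chart : ∀ Y, ChartAnalyticityAsCited ((𝔖 k).Ψ Y) κc.ρ
      (C25 * S.gk k * Real.exp (-(κ * (tsys 3 (nblkOf S K k)).dj Y))))
    (bound28 : ∀ Y h U, ‖(𝔖 k).Bcfg Y h U‖ ≤ κc.cB * (rFun κc.r₀ (S.gk k) * S.gk k * pFun K.b₀ K.p₀ (S.gk k)))
    (small28 : κc.cB * (rFun κc.r₀ (S.gk k) * S.gk k * pFun K.b₀ K.p₀ (S.gk k)) ≤ κc.ρ / 4)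
    (far_le : FarTermsDecayAsCited (𝔖 k).far
      (fun Y => C25 * S.gk k * Real.exp (-(κ * (tsys 3 (nblkOf S K k)).dj Y)))
      κc.Cfar (S.gk k ^ 7 * (rFun κc.r₀ (S.gk k) * pFun K.b₀ K.p₀ (S.gk k)) ^ 7))
    (hPY : ∀ h U, (𝔖 k).PY h U
      = ∑ Y ∈ (𝔖 k).loc (ΩblkOf K.M₁ (rcolOf S K) (nblkOf S K k)) (rretOf S K k) h,
          ((jet26 ((𝔖 k).Ψ Y) ((𝔖 k).Bcfg Y h U)).re - (𝔖 k).far Y h U))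
    {Γ : Type} {π : Γ → (𝔖 k).E →L[ℂ] (𝔖 k).E}
    (Λc : LogZLocalizedAsCited (stdTowerInput X K 𝔖).tower3.toTowerRun k (𝔖 k).E π κc.ρ κc.r₀ κc.Cfar C63 κ
      (seriesPieces (X.toTowerBase K) 𝔖 (piecesParamsOf S K) k).logZU
      (seriesPieces (X.toTowerBase K) 𝔖 (piecesParamsOf S K) k).logZ1 (𝔖 k).Bcfg
      (fun h => Finset.univ.filter fun Y : (tsys 3 (nblkOf S K k)).Dom =>
        Y.1 ⊆ ΩblkOf K.M₁ (rcolOf S K) (nblkOf S K k) h))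
    (N45 : NewbornTerms45AsCited (stdTowerInput X K 𝔖).tower3.toTowerRun k (𝔖 k).E π κc.ρ κc.r₀ κc.Cfar C63 κ
      (seriesPieces (X.toTowerBase K) 𝔖 (piecesParamsOf S K) k).logZU
      (seriesPieces (X.toTowerBase K) 𝔖 (piecesParamsOf S K) k).logZ1 (𝔖 k).Bcfg
      (fun h => Finset.univ.filter fun Y : (tsys 3 (nblkOf S K k)).Dom =>
        Y.1 ⊆ ΩblkOf K.M₁ (rcolOf S K) (nblkOf S K k) h) Λc C45)
    (hPYZ : ∀ h U, (𝔖 k).PYZ h U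
      = ∑ Y ∈ (𝔖 k).loc (ΩblkOf K.M₁ (rcolOf S K) (nblkOf S K k)) (rretOf S K k) h,
          ((jet26 (Λc.Ψ Y) ((𝔖 k).Bcfg Y h U)).re - Λc.far Y h U)) :
    ∀ (h : Hist S.P (k + 1)) (U : GaugeField S.P (k + 1) G),
      |(𝔖 k).PY h U + (𝔖 k).PYZ h U|
        ≤ Cnew46 L κc C25 C63 C45 K.b₀ K.p₀ * (S.gk k * B10.pFun K.b₀ K.p₀ (S.gk k)) ^ 2
            * (LamFin K.M₁ (rcolOf S K) k h).card :=
  newborn46_series (X.toTowerBase K) 𝔖 (piecesParamsOf S K) k hk hk1 κc hκ hC25 hC63 hb₀ hp₀ hr₀ rfl chart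
    bound28 small28 far_le hPY Λc N45 hPYZ

end Std

end Summit.QuantumFields.Balaban3D.Proofs.Newborn46

end
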